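import Summits.KontsevichZagierPeriods.Zeta5Search.QWedgeCFQInterpolation
import Summits.KontsevichZagierPeriods.Zeta5Search.WedgeDictionaryVanishing

/-!
# CF-Q (5/5): `QWedgeClosedForm` is a theorem

HONEST FRAMING: systematic search; no irrationality claim unless certified.

Cell `pub-zeta5`, TYPER g6.  Part of the Lean proof of **CF-Q** (`WedgeDictionary.QWedgeClosedForm`, the closed form of
Brown–Zudilin's leading coefficient `Q(a)` (arXiv:2210.03391, (17)) on the eight-parameter wedge as a factorial ratio
times a terminating very-well-poised `₉F₈(1)`), found and proved on paper by planner gen-1 g4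
(`pub-zeta5-gen-1/PROOF-NOTES-g4.md` §9: trinomial revision → Burchnall–Chaundy/Dougall → Pfaff–Saalschütz ×4 → a
Pochhammer identity), formalised here.  Files: `QWedgeCFQBasic` (toolkit, the `b`-coordinate double sum, Step 1),
`QWedgeCFQKernel` (Steps 2–3), `QWedgeCFQAssembly` (Step 4, the identity for `n ≥ 2S+2`), `QWedgeCFQInterpolation`
(polynomial interpolation in `n` down to the pair conditions), `QWedgeClosedFormProof` (the dictionary `a ↔ (n,b)` and
`QWedgeClosedForm_holds`).

This file: the dictionary `a = a(n;b)` (`a = (n−b₁−b₂, b₂, n−b₂−b₃, b₃, n−b₃−b₄, n−b₅−b₆, n−b₆−b₇, n−b₃−b₅)`),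
Brown–Zudilin's `(p;q)` of (11) in these coordinates, the reindexing `k₁ = p₁ + i`, `k₂ = p₄ + j`, `u = b₃ − i`,
`v = b₇ − j` of the double sum (17) (`QOf_eq_sign_mul_LsumZ : Q(a) = (−1)^{n+S}·L(b;n)`), `omegaVWP (bOfA a) = OmegaQ`,
and the conclusion **`WedgeDictionary.QWedgeClosedForm_holds : QWedgeClosedForm`** (stated in the conjecture's own
namespace, next to gen-1's `casoratianVanishing_holds` / `QWedgeVanishing_holds`).  With `WedgeDictionaryVanishing.qPart_of_closedForms'`
the `Q`-part of the wedge dictionary is thereby reduced to CF-M3 (`casoratianClosedForm`) alone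
(`qPart_of_casoratianClosedForm`).
-/

open Finset Polynomial

namespace Summit.KontsevichZagierPeriods.Zeta5Search.CFQ

open Summit.KontsevichZagierPeriods.Zeta5Search.Hypergeometric
open Literature.NumberTheory.Irrationality.BrownZudilin2022 (zchoose)

/-! ## (C) From Brown–Zudilin's `Q(a)` (17) to the `b`-coordinate double sum, and `QWedgeClosedForm` -/

section link

open Summit.KontsevichZagierPeriods.Zeta5Search.WedgeDictionary
open Summit.KontsevichZagierPeriods.Zeta5Search.DualSeries (InBox)
open Literature.NumberTheory.Irrationality.BrownZudilin2022 (bOfA Converges convergenceForms QOf Qcoeff pOf qOf)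

/-- A shifted integer interval sum as a `range` sum. -/
theorem sum_Icc_int_shift {M : Type*} [AddCommMonoid M] (A : ℤ) (L : ℕ) (f : ℤ → M) :
    ∑ k ∈ Icc A (A + L), f k = ∑ i ∈ range (L + 1), f (A + i) := by
  have h : Icc A (A + L) = (range (L + 1)).map ⟨fun i : ℕ => A + i, fun i j hij => by simpa using hij⟩ := by
    ext k
    simp only [mem_Icc, mem_map, mem_range, Function.Embedding.coeFn_mk]
    constructor
    · rintro ⟨h1, h2⟩; exact ⟨(k - A).toNat, by omega, by omega⟩
    · rintro ⟨i, hi, rfl⟩; omega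
  rw [h, sum_map]
  rfl

/-- Symmetry of the integer binomial: `zchoose N (N − K) = zchoose N K` for `N ≥ 0`. -/
theorem zchoose_symm {N K : ℤ} (hN : 0 ≤ N) : zchoose N (N - K) = zchoose N K := by
  unfold zchoose
  by_cases h : 0 ≤ K ∧ K ≤ N
  · rw [if_pos (by omega), if_pos h]
    obtain ⟨n, rfl⟩ := Int.eq_ofNat_of_zero_le hN
    obtain ⟨k, rfl⟩ := Int.eq_ofNat_of_zero_le h.1
    have hk : k ≤ n := by exact_mod_cast h.2
    rw [show (n : ℤ) - k = ((n - k : ℕ) : ℤ) by omega, Int.toNat_natCast, Int.toNat_natCast, Int.toNat_natCast,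
      Nat.choose_symm hk]
  · rw [if_neg (by omega), if_neg h]

/-- Congruence for `zchoose` through the symmetry `K ↦ N − K`. -/
theorem zchoose_congr_symm {N K N' K' : ℤ} (hN : N = N') (hK : K' = N - K) (h0 : 0 ≤ N) :
    zchoose N K = zchoose N' K' := by
  subst hN; subst hK; exact (zchoose_symm h0).symm

/-- Plain congruence for `zchoose`. -/
theorem zchoose_congr {N K N' K' : ℤ} (hN : N = N') (hK : K = K') : zchoose N K = zchoose N' K' := by
  subst hN; subst hK; rfl

/-- `p₃` (component of `pOf`, definitional). -/
theorem pOf_apply_3' (a : Fin 8 → ℤ) : pOf a 3 = a 1 + a 2 + a 5 - a 7 := rfl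
/-- `q₃` (component of `qOf`, definitional). -/
theorem qOf_apply_2' (a : Fin 8 → ℤ) : qOf a 2 = a 0 + a 4 - a 2 := rfl
/-- `q₅` (component of `qOf`, definitional). -/
theorem qOf_apply_4' (a : Fin 8 → ℤ) : qOf a 4 = a 1 := rfl

/-- `Σ_i p_i = 7n − 6b₆ − S` in the `a`-coordinates. -/
theorem sum_pOf (a : Fin 8 → ℤ) : ∑ i, pOf a i =
    (a 4 + a 5 - a 7) + (a 1 + a 2 + a 5 - a 3 - a 7) + a 5 + (a 1 + a 2 + a 5 - a 7) + a 6 +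
      (a 2 + a 5 - a 7) + (a 0 + a 1 + a 5 - a 3 - a 7) := by
  simp [Fin.sum_univ_succ, pOf]
  ring

/-- The `b`-coordinates of `a` as natural numbers. -/
def bN (a : Fin 8 → ℤ) (j : ℕ) : ℕ := (bOfA a j).toNat

/-- **`Q(a) = (−1)^{n+S} · L(b;n)`**: Brown–Zudilin's double sum (17) in the `b`-coordinates of the wedge
(`n = b₀`, `b = b(a)`), for `a` with `b(a) ≥ 0` and the pair sums `b₁+b₂, b₃+b₆, b₆+b₇, b₁+b₆, b₂+b₆, b₄+b₆,
b₅+b₆ ≤ b₀`. -/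
theorem QOf_eq_sign_mul_LsumZ (a : Fin 8 → ℤ) (hnn : ∀ j, j ≤ 7 → 0 ≤ bOfA a j)
    (h12 : bOfA a 1 + bOfA a 2 ≤ bOfA a 0) (h36 : bOfA a 3 + bOfA a 6 ≤ bOfA a 0)
    (h67 : bOfA a 6 + bOfA a 7 ≤ bOfA a 0) (h16 : bOfA a 1 + bOfA a 6 ≤ bOfA a 0)
    (h26 : bOfA a 2 + bOfA a 6 ≤ bOfA a 0) (h46 : bOfA a 4 + bOfA a 6 ≤ bOfA a 0)
    (h56 : bOfA a 5 + bOfA a 6 ≤ bOfA a 0) :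
    QOf a = (-1) ^ (bN a 0 + S7 (bN a)) * LsumZ (bN a 0) (bN a) := by
  -- the dictionary `a = a(n;b)`
  have hb0 : ((bN a 0 : ℕ) : ℤ) = bOfA a 0 := Int.toNat_of_nonneg (hnn 0 (by norm_num))
  have hb1 : ((bN a 1 : ℕ) : ℤ) = bOfA a 1 := Int.toNat_of_nonneg (hnn 1 (by norm_num))
  have hb2 : ((bN a 2 : ℕ) : ℤ) = bOfA a 2 := Int.toNat_of_nonneg (hnn 2 (by norm_num))
  have hb3 : ((bN a 3 : ℕ) : ℤ) = bOfA a 3 := Int.toNat_of_nonneg (hnn 3 (by norm_num))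
  have hb4 : ((bN a 4 : ℕ) : ℤ) = bOfA a 4 := Int.toNat_of_nonneg (hnn 4 (by norm_num))
  have hb5 : ((bN a 5 : ℕ) : ℤ) = bOfA a 5 := Int.toNat_of_nonneg (hnn 5 (by norm_num))
  have hb6 : ((bN a 6 : ℕ) : ℤ) = bOfA a 6 := Int.toNat_of_nonneg (hnn 6 (by norm_num))
  have hb7 : ((bN a 7 : ℕ) : ℤ) = bOfA a 7 := Int.toNat_of_nonneg (hnn 7 (by norm_num))
  simp only [bOfA] at hb0 hb1 hb2 hb3 hb4 hb5 hb6 hb7 h12 h36 h67 h16 h26 h46 h56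
  set n := bN a 0 with hn
  set b := bN a
  have e0 : a 0 = (n : ℤ) - b 1 - b 2 := by omega
  have e1 : a 1 = (b 2 : ℤ) := by omega
  have e2 : a 2 = (n : ℤ) - b 2 - b 3 := by omega
  have e3 : a 3 = (b 3 : ℤ) := by omega
  have e4 : a 4 = (n : ℤ) - b 3 - b 4 := by omega
  have e5 : a 5 = (n : ℤ) - b 5 - b 6 := by omega
  have e6 : a 6 = (n : ℤ) - b 6 - b 7 := by omega
  have e7 : a 7 = (n : ℤ) - b 3 - b 5 := by omega
  -- unfold (17) and pass to the `(n, b)` coordinates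
  unfold QOf Qcoeff
  rw [sum_pOf, pOf_apply_0, pOf_apply_1, pOf_apply_2, pOf_apply_3', pOf_apply_4, pOf_apply_5, pOf_apply_6,
    qOf_apply_0, qOf_apply_1, qOf_apply_2', qOf_apply_3, qOf_apply_4']
  have hp0 : a 4 + a 5 - a 7 = (n : ℤ) - b 4 - b 6 := by omega
  have hp1 : a 1 + a 2 + a 5 - a 3 - a 7 = (n : ℤ) - b 3 - b 6 := by omega
  have hp3 : a 1 + a 2 + a 5 - a 7 = (n : ℤ) - b 6 := by omega
  have hp5 : a 2 + a 5 - a 7 = (n : ℤ) - b 2 - b 6 := by omega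
  have hp6 : a 0 + a 1 + a 5 - a 3 - a 7 = (n : ℤ) - b 1 - b 6 := by omega
  have hq2 : a 0 + a 4 - a 2 = (n : ℤ) - b 1 - b 4 := by omega
  rw [hp1, hp6, hp3, hp0, hp5, hq2, e5, e6, e3, e4, e0, e1]
  -- the sign `(−1)^{Σ p_i} = (−1)^{n+S}`
  have hsign : ((-1 : ℤ)) ^ ((n : ℤ) - b 4 - b 6 + ((n : ℤ) - b 3 - b 6) + ((n : ℤ) - b 5 - b 6) + ((n : ℤ) - b 6) +
        ((n : ℤ) - b 6 - b 7) + ((n : ℤ) - b 2 - b 6) + ((n : ℤ) - b 1 - b 6)).toNat = (-1) ^ (n + S7 b) := by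
    rw [neg_one_pow_eq_pow_mod_two, neg_one_pow_eq_pow_mod_two (R := ℤ) (n := n + S7 b)]
    congr 1
    unfold S7
    omega
  rw [hsign]
  congr 1
  -- shift both summation intervals to `range`
  rw [sum_Icc_int_shift,
    show (n : ℤ) - b 6 - b 7 + ((n : ℤ) - b 1 - b 2) = ((n : ℤ) - b 6 - b 7) + ((n - b 1 - b 2 : ℕ) : ℤ) by omega]
  simp_rw [sum_Icc_int_shift]
  -- `L(b;n)` with the `u`-index reflected
  unfold LsumZ
  rw [← sum_range_reflect]
  refine sum_congr rfl fun i hi => ?_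
  rw [mem_range] at hi
  -- the `j`-range: `range (n−b₁−b₂+1)` and `range (b₇+1)` give the same sum (zero terms beyond either bound)
  refine Eq.trans (sum_subset (s₂ := range (n - b 1 - b 2 + b 7 + 1)) (range_subset_range.2 (by omega)) ?_) ?_
  · intro j hj hj'
    rw [mem_range] at hj hj'
    exact mul_eq_zero_of_left (mul_eq_zero_of_right _ (zchoose_lt (by omega))) _
  refine Eq.trans (sum_subset (s₁ := range (b 7 + 1)) (range_subset_range.2 (by omega)) ?_).symm ?_
  · intro j hj hj'
    rw [mem_range] at hj hj'
    exact mul_eq_zero_of_right _ (zchoose_lt (by omega))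
  -- reflect the `v`-index and compare the seven factors (`u = b₃ − i`, `v = b₇ − j`)
  rw [← sum_range_reflect]
  refine sum_congr rfl fun j hj => ?_
  rw [mem_range] at hj
  unfold termZ
  have hu : ((b 3 + 1 - 1 - i : ℕ) : ℤ) = (b 3 : ℤ) - i := by omega
  have hv : ((b 7 + 1 - 1 - j : ℕ) : ℤ) = (b 7 : ℤ) - j := by omega
  rw [hu, hv]
  refine congrArg₂ (· * ·) (congrArg₂ (· * ·) (congrArg₂ (· * ·) (congrArg₂ (· * ·) (congrArg₂ (· * ·)
    (congrArg₂ (· * ·) ?_ ?_) ?_) ?_) ?_) ?_) ?_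
  · exact zchoose_congr_symm (by ring) (by ring) (by omega)
  · exact zchoose_congr_symm (by ring) (by ring) (by omega)
  · exact zchoose_congr (by ring) (by ring)
  · exact zchoose_congr_symm rfl (by ring) (by omega)
  · exact zchoose_congr rfl (by ring)
  · exact zchoose_congr rfl (by ring)
  · exact zchoose_congr_symm rfl (by ring) (by omega)

end link

section final

open Summit.KontsevichZagierPeriods.Zeta5Search.WedgeDictionary
open Summit.KontsevichZagierPeriods.Zeta5Search.DualSeries (InBox)
open Literature.NumberTheory.Irrationality.BrownZudilin2022 (bOfA Converges convergenceForms QOf Qcoeff pOf qOf)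

/-- `Ω` of the tree (`omegaVWP`, integer parameter vector) is `OmegaQ` of this file at `n = b₀`, `b = b(a)`. -/
theorem omegaVWP_eq_OmegaQ (a : Fin 8 → ℤ) (hnn : ∀ j, j ≤ 7 → 0 ≤ bOfA a j) :
    omegaVWP (bOfA a) = OmegaQ (bN a 0) (bN a) := by
  have hq : ∀ j, j ≤ 7 → ((bOfA a j : ℤ) : ℚ) = ((bN a j : ℕ) : ℚ) := by
    intro j hj
    have h : ((bN a j : ℕ) : ℤ) = bOfA a j := Int.toNat_of_nonneg (hnn j hj)
    rw [← h, Int.cast_natCast]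
  unfold omegaVWP OmegaQ OmegaTerm ph
  rw [show (bOfA a 0).toNat = bN a 0 from rfl, hq 0 (by norm_num)]
  refine sum_congr rfl fun m _ => ?_
  congr 1
  refine prod_congr rfl fun j hj => ?_
  rw [mem_range] at hj
  rw [hq (j + 1) (by omega)]

end final

end Summit.KontsevichZagierPeriods.Zeta5Search.CFQ

namespace Summit.KontsevichZagierPeriods.Zeta5Search.WedgeDictionary

open Summit.KontsevichZagierPeriods.Zeta5Search.CFQ
open Summit.KontsevichZagierPeriods.Zeta5Search.DualSeries (InBox)
open Literature.NumberTheory.Irrationality.BrownZudilin2022 (bOfA Converges convergenceForms QOf Qcoeff pOf qOf zchoose)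

/-- **CF-Q is a theorem**: Brown–Zudilin's leading coefficient `Q(a)` on the eight-parameter wedge is the
factorial ratio times the terminating very-well-poised `₉F₈(1)` `Ω(b(a))` — the conjecture `QWedgeClosedForm`
of `WedgeDictionaryClosedForms` (gen-1 g4, found by exact computation) holds for every `a` in its stated range. -/
theorem QWedgeClosedForm_holds : QWedgeClosedForm := by
  intro a hconv hreg hd hne
  have hE := epairs_le_of_converges a hconv
  have h12 := hE (1,2) (by simp [Epairs]); have h13 := hE (1,3) (by simp [Epairs])
  have h14 := hE (1,4) (by simp [Epairs]); have h15 := hE (1,5) (by simp [Epairs])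
  have h23 := hE (2,3) (by simp [Epairs]); have h24 := hE (2,4) (by simp [Epairs])
  have h25 := hE (2,5) (by simp [Epairs]); have h26 := hE (2,6) (by simp [Epairs])
  have h34 := hE (3,4) (by simp [Epairs]); have h36 := hE (3,6) (by simp [Epairs])
  have h37 := hE (3,7) (by simp [Epairs]); have h47 := hE (4,7) (by simp [Epairs])
  have h56 := hE (5,6) (by simp [Epairs]); have h57 := hE (5,7) (by simp [Epairs])
  have h67 := hE (6,7) (by simp [Epairs])
  have h16 := hne (1,6) (by simp [nonEpairs]); have h17 := hne (1,7) (by simp [nonEpairs])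
  have h27 := hne (2,7) (by simp [nonEpairs]); have h35 := hne (3,5) (by simp [nonEpairs])
  have h45 := hne (4,5) (by simp [nonEpairs]); have h46 := hne (4,6) (by simp [nonEpairs])
  simp only at h12 h13 h14 h15 h23 h24 h25 h26 h34 h36 h37 h47 h56 h57 h67 h16 h17 h27 h35 h45 h46
  have hr1 := (hreg 1 (by simp)).1; have hr2 := (hreg 2 (by simp)).1; have hr3 := (hreg 3 (by simp)).1
  have hr4 := (hreg 4 (by simp)).1; have hr5 := (hreg 5 (by simp)).1; have hr6 := (hreg 6 (by simp)).1
  have hr7 := (hreg 7 (by simp)).1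
  have hnn : ∀ j, j ≤ 7 → 0 ≤ bOfA a j := by
    intro j hj
    interval_cases j
    · linarith
    all_goals assumption
  -- natural-number coordinates
  have hb0 : ((bN a 0 : ℕ) : ℤ) = bOfA a 0 := Int.toNat_of_nonneg (hnn 0 (by norm_num))
  have hb1 : ((bN a 1 : ℕ) : ℤ) = bOfA a 1 := Int.toNat_of_nonneg (hnn 1 (by norm_num))
  have hb2 : ((bN a 2 : ℕ) : ℤ) = bOfA a 2 := Int.toNat_of_nonneg (hnn 2 (by norm_num))
  have hb3 : ((bN a 3 : ℕ) : ℤ) = bOfA a 3 := Int.toNat_of_nonneg (hnn 3 (by norm_num))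
  have hb4 : ((bN a 4 : ℕ) : ℤ) = bOfA a 4 := Int.toNat_of_nonneg (hnn 4 (by norm_num))
  have hb5 : ((bN a 5 : ℕ) : ℤ) = bOfA a 5 := Int.toNat_of_nonneg (hnn 5 (by norm_num))
  have hb6 : ((bN a 6 : ℕ) : ℤ) = bOfA a 6 := Int.toNat_of_nonneg (hnn 6 (by norm_num))
  have hb7 : ((bN a 7 : ℕ) : ℤ) = bOfA a 7 := Int.toNat_of_nonneg (hnn 7 (by norm_num))
  have hQ := QOf_eq_sign_mul_LsumZ a hnn h12 h36 h67 h16 h26 h46 h56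
  have hΩ := omegaVWP_eq_OmegaQ a hnn
  set n := bN a 0 with hn
  set b := bN a with hbdef
  have hp : PairCond n b := by
    unfold PairCond; refine ⟨?_, ?_, ?_, ?_, ?_, ?_, ?_, ?_, ?_, ?_, ?_⟩ <;> omega
  have key := cfq_bform hp
  -- rewrite the statement in the coordinates `(n, b)`
  rw [hQ, hΩ]
  have t0 : (bOfA a 0).toNat = n := rfl
  have t1 : (bOfA a 1).toNat = b 1 := rfl
  have t4 : (bOfA a 4).toNat = b 4 := rfl
  have t5 : (bOfA a 5).toNat = b 5 := rfl
  have t6 : (bOfA a 6).toNat = b 6 := rfl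
  have t7 : (bOfA a 7).toNat = b 7 := rfl
  have d16 : (bOfA a 0 - bOfA a 1 - bOfA a 6).toNat = n - b 1 - b 6 := by omega
  have d17 : (bOfA a 0 - bOfA a 1 - bOfA a 7).toNat = n - b 1 - b 7 := by omega
  have d27 : (bOfA a 0 - bOfA a 2 - bOfA a 7).toNat = n - b 2 - b 7 := by omega
  have d35 : (bOfA a 0 - bOfA a 3 - bOfA a 5).toNat = n - b 3 - b 5 := by omega
  have d45 : (bOfA a 0 - bOfA a 4 - bOfA a 5).toNat = n - b 4 - b 5 := by omega
  have d46 : (bOfA a 0 - bOfA a 4 - bOfA a 6).toNat = n - b 4 - b 6 := by omega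
  have s1 : (bOfA a 0 - bOfA a 1).toNat = n - b 1 := by omega
  have s2 : (bOfA a 0 - bOfA a 2).toNat = n - b 2 := by omega
  have s3 : (bOfA a 0 - bOfA a 3).toNat = n - b 3 := by omega
  have s4 : (bOfA a 0 - bOfA a 4).toNat = n - b 4 := by omega
  have s5 : (bOfA a 0 - bOfA a 5).toNat = n - b 5 := by omega
  have s6 : (bOfA a 0 - bOfA a 6).toNat = n - b 6 := by omega
  have s7 : (bOfA a 0 - bOfA a 7).toNat = n - b 7 := by omega
  have hS : (∑ j ∈ range 7, bOfA a (j + 1)).toNat = S7 b := by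
    simp only [sum_range_succ, sum_range_zero, zero_add, Nat.reduceAdd]
    unfold S7; omega
  simp only [nonEpairs, List.map, List.prod_cons, List.prod_nil, prod_range_succ, prod_range_zero, one_mul,
    zero_add, Nat.reduceAdd, t0, t1, t4, t5, t6, t7, d16, d17, d27, d35, d45, d46, s1, s2, s3, s4, s5, s6, s7, hS]
  push_cast
  unfold fq at key
  linear_combination ((-1 : ℚ) ^ (n + S7 b)) * key

/-- **CF-Q in quotient form**: on the region of `QWedgeClosedForm`,
`Q(a) = (−1)^{b₀+Σb_j} · ∏_j (b₀−b_j)! · Ω(b) / (b₀! · b₁!b₄!b₅!b₆!b₇! · ∏_N (b₀−b_j−b_k)!)`, `b = b(a)`. -/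
theorem QOf_eq_closedForm (a : Fin 8 → ℤ) (hconv : Converges a)
    (hreg : ∀ i ∈ Icc 1 7, 0 ≤ bOfA a i ∧ 2 * bOfA a i ≤ bOfA a 0 + 1) (hd : 0 ≤ dOf (bOfA a))
    (hne : ∀ jk ∈ nonEpairs, bOfA a jk.1 + bOfA a jk.2 ≤ bOfA a 0) :
    (QOf a : ℚ) =
      (-1 : ℚ) ^ ((bOfA a 0).toNat + (∑ j ∈ range 7, bOfA a (j + 1)).toNat) *
        (∏ j ∈ range 7, ((bOfA a 0 - bOfA a (j + 1)).toNat.factorial : ℚ)) * omegaVWP (bOfA a) /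
      ((((bOfA a 0).toNat.factorial : ℚ) *
        (([1, 4, 5, 6, 7] : List ℕ).map fun j => ((bOfA a j).toNat.factorial : ℚ)).prod) *
        (nonEpairs.map fun jk => ((bOfA a 0 - bOfA a jk.1 - bOfA a jk.2).toNat.factorial : ℚ)).prod) := by
  have h := QWedgeClosedForm_holds a hconv hreg hd hne
  have hX : ((((bOfA a 0).toNat.factorial : ℚ) *
      (([1, 4, 5, 6, 7] : List ℕ).map fun j => ((bOfA a j).toNat.factorial : ℚ)).prod) *
      (nonEpairs.map fun jk => ((bOfA a 0 - bOfA a jk.1 - bOfA a jk.2).toNat.factorial : ℚ)).prod) ≠ 0 := by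
    simp only [nonEpairs, List.map, List.prod_cons, List.prod_nil]
    positivity
  rw [eq_div_iff hX, h]

/-- **COROLLARY.** The `Q`-part of `wedgeDictionary` (`Q(a) = ρ(a)·M₃(b(a))` on the whole region) now follows from
CF-M3 (`casoratianClosedForm`) ALONE. -/
theorem qPart_of_casoratianClosedForm (hM : casoratianClosedForm) (a : Fin 8 → ℤ) (hconv : Converges a)
    (hreg : ∀ i ∈ Icc 1 7, 0 ≤ bOfA a i ∧ 2 * bOfA a i ≤ bOfA a 0 + 1) (hd : 0 ≤ dOf (bOfA a)) :
    (QOf a : ℚ) = rhoOf a * quadM3 (bOfA a) :=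
  qPart_of_closedForms' hM QWedgeClosedForm_holds a hconv hreg hd

/-- **Pointwise version.** For a single `a` in the region with ALL 21 pair sums `≤ b₀`, the CF-M3 identity AT `b(a)` alone
gives the `Q`-part of `wedgeDictionary` at `a` (for use with partial results on CF-M3, e.g. lit g4's face theorem). -/
theorem qPart_of_casoratianClosedForm_at (a : Fin 8 → ℤ) (hconv : Converges a)
    (hreg : ∀ i ∈ Icc 1 7, 0 ≤ bOfA a i ∧ 2 * bOfA a i ≤ bOfA a 0 + 1) (hd : 0 ≤ dOf (bOfA a))
    (hall : ∀ jk ∈ allPairs, bOfA a jk.1 + bOfA a jk.2 ≤ bOfA a 0)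
    (hMa : quadM3 (bOfA a) * ((((bOfA a 0).toNat.factorial : ℚ)) *
        (allPairs.map fun jk => ((bOfA a 0 - bOfA a jk.1 - bOfA a jk.2).toNat.factorial : ℚ)).prod) =
      (-1 : ℚ) ^ (bOfA a 0).toNat * 4 * ((dOf (bOfA a)).toNat.factorial : ℚ) *
        (∏ j ∈ range 7, ((bOfA a 0 - bOfA a (j + 1)).toNat.factorial : ℚ)) * omegaVWP (bOfA a)) :
    (QOf a : ℚ) = rhoOf a * quadM3 (bOfA a) := by
  have hne : ∀ jk ∈ nonEpairs, bOfA a jk.1 + bOfA a jk.2 ≤ bOfA a 0 := by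
    intro jk hjk
    simp only [nonEpairs, List.mem_cons, List.mem_nil_iff, or_false] at hjk
    rcases hjk with rfl | rfl | rfl | rfl | rfl | rfl <;> exact hall _ (by simp [allPairs])
  have h2 := QWedgeClosedForm_holds a hconv hreg hd hne
  have hX : ((((bOfA a 0).toNat.factorial : ℚ) *
      (([1, 4, 5, 6, 7] : List ℕ).map fun j => ((bOfA a j).toNat.factorial : ℚ)).prod) *
      (nonEpairs.map fun jk => ((bOfA a 0 - bOfA a jk.1 - bOfA a jk.2).toNat.factorial : ℚ)).prod) ≠ 0 := by
    simp only [nonEpairs, List.map, List.prod_cons, List.prod_nil]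
    positivity
  have hZ : (((bOfA a 0).toNat.factorial : ℚ) *
      (allPairs.map fun jk => ((bOfA a 0 - bOfA a jk.1 - bOfA a jk.2).toNat.factorial : ℚ)).prod) ≠ 0 := by
    simp only [allPairs, List.map, List.prod_cons, List.prod_nil]
    positivity
  have hq := eq_div_of_mul_eq hX h2
  have hm := eq_div_of_mul_eq hZ hMa
  rw [hq, hm]
  simp only [rhoOf, Epairs, allPairs, nonEpairs, List.map, List.prod_cons, List.prod_nil, mul_one, pow_add]
  field_simp

/-- **Vanishing branch (unconditional).** If one of the six (35)-pair sums exceeds `b₀`, both sides of the `Q`-part vanish. -/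
theorem qPart_of_exceeding_pair (a : Fin 8 → ℤ) (hconv : Converges a)
    (hreg : ∀ i ∈ Icc 1 7, 0 ≤ bOfA a i ∧ 2 * bOfA a i ≤ bOfA a 0 + 1) (hd : 0 ≤ dOf (bOfA a))
    (hex : ∃ jk ∈ nonEpairs, bOfA a 0 < bOfA a jk.1 + bOfA a jk.2) :
    (QOf a : ℚ) = rhoOf a * quadM3 (bOfA a) := by
  have hnn : ∀ i ∈ Icc 1 7, 0 ≤ bOfA a i := fun i hi => (hreg i hi).1
  obtain ⟨hIB, hle⟩ := inBox_of_full a hconv hnn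
  obtain ⟨jk, hjk, hlt⟩ := hex
  have hQ0 : QOf a = 0 := QWedgeVanishing_holds a hconv hreg hd ⟨jk, hjk, hlt⟩
  have hjk' : jk ∈ allPairs := by
    simp only [nonEpairs, List.mem_cons, List.mem_nil_iff, or_false] at hjk
    rcases hjk with rfl | rfl | rfl | rfl | rfl | rfl <;> simp [allPairs]
  have hM0 : quadM3 (bOfA a) = 0 := casoratianVanishing_holds (bOfA a) hIB hd hle ⟨jk, hjk', hlt⟩
  simp [hQ0, hM0]

end Summit.KontsevichZagierPeriods.Zeta5Search.WedgeDictionary
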